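import Summits.ABC.ABC.Theses.FeketeScales

/-!
# The power-shape descent identity — stub `powerShape_descent` of crux stmt-ABC-2160 `ScaleSubmultiplicativity` (line SketchIdeator3; card power-shape-cyclotomic-descent)

For an `n`-power-shaped triple `T = (x^n, z^n - x^n, z^n)` (`0 < x < z` coprime, `n ≥ 2`) the
sub-triple `T'' = (x, z - x, z)` and the cofactor
`Φ = (z^n - x^n)/(z - x) = ∑_{i<n} z^i x^{n-1-i}` satisfy: `T` and `T''` are abc triples,
`rad(T'')·rad(Φ) ≤ n·rad(T)`, `z^n ≤ z·Φ` and `Φ ≤ n·z^{n-1}`.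

Proof.  `Φ·(z - x) = z^n - x^n` is `geom_sum₂_mul_of_ge` in `ℕ`, so the `ℕ`-division is
exact.  A prime `p` dividing both `x (z - x) z` and `Φ` divides `n`: `p ∣ x` or `p ∣ z` together
with `p ∣ Φ ∣ z^n - x^n` would give `p ∣ gcd(x, z) = 1`; hence `p ∣ z - x`, and in `ZMod p` one
has `z = x` and `0 = Φ = n·x^{n-1}`, whence `p ∣ n` (as `p ∤ x`).  With `A = x (z - x) z`,
`B = x^n (z^n - x^n) z^n` and `A·Φ ∣ B`, the prime-factor sets give
`rad A · rad Φ = rad(AΦ) · ∏_{p ∣ A, p ∣ Φ} p ≤ rad B · rad n ≤ n · rad B`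
(`Finset.prod_union_inter`).  The two size bounds compare `Φ` with its top term `z^{n-1}` and
with `n` copies of it.

Source: idea card power-shape-cyclotomic-descent (crux workfiles of stmt-ABC-2160), First lemma;
elementary folklore.  Uses Mathlib only.
-/

-- `Summit.<Summit>.<Problem>` is the mandated summit-side namespace (CONVENTIONS §2); for the
-- single-conjunct summit `ABC` the two coincide, so the duplicate `ABC.ABC` is deliberate.
set_option linter.dupNamespace false

namespace Summit.ABC.ABC.Theorems

open Literature.NumberTheory.DiophantineGeometry UniqueFactorizationMonoid Finset

/-- The cyclotomic cofactor dominates its top term: `z^n ≤ z · ∑_{i<n} z^i x^{n-1-i}` for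
`n ≠ 0`. [folklore] -/
theorem ScaleSubmultiplicativity.Descent.pow_le_mul_cofactor (n x z : ℕ) (hn : n ≠ 0) :
    z ^ n ≤ z * ∑ i ∈ range n, z ^ i * x ^ (n - 1 - i) := by
  have hmem : n - 1 ∈ range n := mem_range.mpr (by omega)
  have h1 : z ^ (n - 1) * x ^ (n - 1 - (n - 1)) ≤ ∑ i ∈ range n, z ^ i * x ^ (n - 1 - i) :=
    single_le_sum (f := fun i => z ^ i * x ^ (n - 1 - i)) (fun i _ => Nat.zero_le _) hmem
  rw [Nat.sub_self, pow_zero, mul_one] at h1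
  calc z ^ n = z * z ^ (n - 1) := (mul_pow_sub_one hn z).symm
    _ ≤ z * ∑ i ∈ range n, z ^ i * x ^ (n - 1 - i) := Nat.mul_le_mul_left z h1

/-- The cyclotomic cofactor is at most `n` copies of its top term:
`∑_{i<n} z^i x^{n-1-i} ≤ n · z^{n-1}` for `x ≤ z`. [folklore] -/
theorem ScaleSubmultiplicativity.Descent.cofactor_le (n x z : ℕ) (hxz : x ≤ z) :
    ∑ i ∈ range n, z ^ i * x ^ (n - 1 - i) ≤ n * z ^ (n - 1) := by
  have h := sum_le_card_nsmul (range n) (fun i => z ^ i * x ^ (n - 1 - i)) (z ^ (n - 1)) ?_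
  · simpa [card_range, smul_eq_mul] using h
  · intro i hi
    rw [mem_range] at hi
    calc z ^ i * x ^ (n - 1 - i) ≤ z ^ i * z ^ (n - 1 - i) :=
          Nat.mul_le_mul_left _ (Nat.pow_le_pow_left hxz _)
      _ = z ^ (n - 1) := by rw [← pow_add]; congr 1; omega

/-- Key divisibility: for coprime `x < z` and `n ≥ 2`, a prime dividing both `x (z - x) z` and the
cofactor `Φ = ∑_{i<n} z^i x^{n-1-i}` divides `n` (indeed `p ∤ xz`, so `p ∣ z - x` and
`Φ ≡ n x^{n-1} (mod p)`). [folklore] -/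
theorem ScaleSubmultiplicativity.Descent.prime_dvd_index {n x z p : ℕ} (hn : 2 ≤ n)
    (hxz : x < z) (hcop : Nat.Coprime x z) (hp : p.Prime) (hpA : p ∣ x * (z - x) * z)
    (hpS : p ∣ ∑ i ∈ range n, z ^ i * x ^ (n - 1 - i)) : p ∣ n := by
  have hn0 : n ≠ 0 := by omega
  have hSd : (∑ i ∈ range n, z ^ i * x ^ (n - 1 - i)) * (z - x) = z ^ n - x ^ n :=
    geom_sum₂_mul_of_ge hxz.le n
  have hxn : x ^ n ≤ z ^ n := Nat.pow_le_pow_left hxz.le n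
  have hpzx : p ∣ z ^ n - x ^ n := by
    rw [← hSd]
    exact dvd_mul_of_dvd_left hpS _
  have hnot : ¬(p ∣ x ∧ p ∣ z) := fun h =>
    hp.one_lt.ne' (Nat.eq_one_of_dvd_coprimes hcop h.1 h.2)
  have hpx : ¬p ∣ x := fun hx => by
    refine hnot ⟨hx, hp.dvd_of_dvd_pow (n := n) ?_⟩
    have h := dvd_add hpzx (dvd_pow hx hn0)
    rwa [Nat.sub_add_cancel hxn] at h
  have hpz : ¬p ∣ z := fun hz => by
    refine hnot ⟨hp.dvd_of_dvd_pow (n := n) ?_, hz⟩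
    have h := Nat.dvd_sub (dvd_pow hz hn0) hpzx
    rwa [Nat.sub_sub_self hxn] at h
  have hpd : p ∣ z - x := by
    rcases hp.dvd_mul.mp hpA with h | h
    · rcases hp.dvd_mul.mp h with h | h
      · exact absurd h hpx
      · exact h
    · exact absurd h hpz
  haveI := Fact.mk hp
  have hzx : ((z : ℕ) : ZMod p) = (x : ZMod p) :=
    ((ZMod.natCast_eq_natCast_iff x z p).mpr ((Nat.modEq_iff_dvd' hxz.le).mpr hpd)).symm
  have hS0 : ((∑ i ∈ range n, z ^ i * x ^ (n - 1 - i) : ℕ) : ZMod p) = 0 :=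
    (ZMod.natCast_eq_zero_iff _ p).mpr hpS
  have hSval : ((∑ i ∈ range n, z ^ i * x ^ (n - 1 - i) : ℕ) : ZMod p)
      = (n : ZMod p) * (x : ZMod p) ^ (n - 1) := by
    push_cast
    simp only [hzx]
    calc ∑ i ∈ range n, (x : ZMod p) ^ i * (x : ZMod p) ^ (n - 1 - i)
        = ∑ i ∈ range n, (x : ZMod p) ^ (n - 1) := by
          refine sum_congr rfl fun i hi => ?_
          rw [← pow_add]
          congr 1
          rw [mem_range] at hi
          omega
      _ = (n : ZMod p) * (x : ZMod p) ^ (n - 1) := by rw [sum_const, card_range, nsmul_eq_mul]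
  rw [hSval] at hS0
  rcases mul_eq_zero.mp hS0 with h | h
  · exact (ZMod.natCast_eq_zero_iff n p).mp h
  · exact absurd ((ZMod.natCast_eq_zero_iff x p).mp ((pow_eq_zero_iff (by omega)).mp h)) hpx

/-- Radical bookkeeping: if `a·s ∣ b` (all nonzero) and every prime dividing both `a` and `s`
divides `m ≠ 0`, then `rad a · rad s ≤ m · rad b`, because
`rad a · rad s = rad(as) · ∏_{p ∣ a, p ∣ s} p` and the last product is a product of distinct
primes dividing `m`. [folklore] -/
theorem ScaleSubmultiplicativity.Descent.radical_mul_radical_le {a s b m : ℕ} (ha : a ≠ 0)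
    (hs : s ≠ 0) (hb : b ≠ 0) (hm : m ≠ 0) (hdvd : a * s ∣ b)
    (hkey : ∀ p : ℕ, p.Prime → p ∣ a → p ∣ s → p ∣ m) :
    radical a * radical s ≤ m * radical b := by
  have h1 : radical a * radical s
      = radical (a * s) * ∏ p ∈ a.primeFactors ∩ s.primeFactors, p := by
    simp only [Nat.radical_eq_prod_primeFactors]
    rw [Nat.primeFactors_mul ha hs, prod_union_inter]
  have h2 : radical (a * s) ≤ radical b :=
    Nat.le_of_dvd (Nat.radical_pos _) (radical_dvd_radical hdvd hb)
  have hsub : a.primeFactors ∩ s.primeFactors ⊆ m.primeFactors := by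
    intro p hp
    rw [mem_inter] at hp
    exact (Nat.prime_of_mem_primeFactors hp.1).mem_primeFactors
      (hkey p (Nat.prime_of_mem_primeFactors hp.1) (Nat.dvd_of_mem_primeFactors hp.1)
        (Nat.dvd_of_mem_primeFactors hp.2)) hm
  have h3 : ∏ p ∈ a.primeFactors ∩ s.primeFactors, p ≤ m :=
    calc ∏ p ∈ a.primeFactors ∩ s.primeFactors, p ≤ ∏ p ∈ m.primeFactors, p :=
          Nat.le_of_dvd (prod_pos fun p hp => Nat.pos_of_mem_primeFactors hp)
            (prod_dvd_prod_of_subset _ _ _ hsub)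
      _ = radical m := Nat.radical_eq_prod_primeFactors.symm
      _ ≤ m := Nat.radical_le_self_iff.mpr hm
  calc radical a * radical s
        = radical (a * s) * ∏ p ∈ a.primeFactors ∩ s.primeFactors, p := h1
    _ ≤ radical b * m := Nat.mul_le_mul h2 h3
    _ = m * radical b := mul_comm _ _

/-- **Power-shape descent** (card power-shape-cyclotomic-descent, First lemma).  For an
`n`-power-shaped triple `T = (x^n, z^n - x^n, z^n)` (`0 < x < z` coprime, `n ≥ 2`) the sub-triple
`T'' = (x, z - x, z)` and the cyclotomic cofactor `Φ = (z^n - x^n)/(z - x)` satisfy: `T` and `T''`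
are abc triples, `rad(T'')·rad(Φ) ≤ n·rad(T)` (because a common prime of `x (z - x) z` and `Φ`
divides `n`, as `Φ ≡ n x^{n-1} (mod z - x)`), `z^n ≤ z·Φ` and `Φ ≤ n·z^{n-1}`.
[folklore] -/
theorem ScaleSubmultiplicativity.powerShape_descent (n x z : ℕ) (hn : 2 ≤ n) (hx : 0 < x)
    (hxz : x < z) (hcop : Nat.Coprime x z) :
    IsABCTriple (x ^ n) (z ^ n - x ^ n) (z ^ n) ∧ IsABCTriple x (z - x) z ∧
      rad x (z - x) z * UniqueFactorizationMonoid.radical ((z ^ n - x ^ n) / (z - x))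
        ≤ n * rad (x ^ n) (z ^ n - x ^ n) (z ^ n) ∧
      z ^ n ≤ z * ((z ^ n - x ^ n) / (z - x)) ∧
      (z ^ n - x ^ n) / (z - x) ≤ n * z ^ (n - 1) := by
  have hn0 : n ≠ 0 := by omega
  have hz : 0 < z := hx.trans hxz
  have hxn : x ^ n < z ^ n := Nat.pow_lt_pow_left hxz hn0
  have hd : 0 < z - x := Nat.sub_pos_of_lt hxz
  -- the cofactor `Φ = ∑_{i<n} z^i x^{n-1-i}` and the descent identity `Φ (z - x) = z^n - x^n`
  have hSd : (∑ i ∈ range n, z ^ i * x ^ (n - 1 - i)) * (z - x) = z ^ n - x ^ n :=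
    geom_sum₂_mul_of_ge hxz.le n
  have hΦ : (z ^ n - x ^ n) / (z - x) = ∑ i ∈ range n, z ^ i * x ^ (n - 1 - i) :=
    Nat.div_eq_of_eq_mul_left hd hSd.symm
  rw [hΦ]
  refine ⟨⟨pow_pos hx n, Nat.sub_pos_of_lt hxn, Nat.add_sub_cancel' hxn.le,
      (Nat.coprime_sub_self_right hxn.le).mpr (hcop.pow n n)⟩,
    ⟨hx, hd, Nat.add_sub_cancel' hxz.le, (Nat.coprime_sub_self_right hxz.le).mpr hcop⟩, ?_,
    ScaleSubmultiplicativity.Descent.pow_le_mul_cofactor n x z hn0,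
    ScaleSubmultiplicativity.Descent.cofactor_le n x z hxz.le⟩
  -- the radical inequality
  have hS0 : (∑ i ∈ range n, z ^ i * x ^ (n - 1 - i)) ≠ 0 := by
    intro h
    rw [h, zero_mul] at hSd
    omega
  have hA0 : x * (z - x) * z ≠ 0 :=
    Nat.pos_iff_ne_zero.mp (Nat.mul_pos (Nat.mul_pos hx hd) hz)
  have hB0 : x ^ n * (z ^ n - x ^ n) * z ^ n ≠ 0 :=
    Nat.pos_iff_ne_zero.mp (Nat.mul_pos (Nat.mul_pos (pow_pos hx n) (Nat.sub_pos_of_lt hxn))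
      (pow_pos hz n))
  have hdvd : x * (z - x) * z * (∑ i ∈ range n, z ^ i * x ^ (n - 1 - i))
      ∣ x ^ n * (z ^ n - x ^ n) * z ^ n := by
    refine ⟨x ^ (n - 1) * z ^ (n - 1), ?_⟩
    rw [← hSd, ← mul_pow_sub_one hn0 x, ← mul_pow_sub_one hn0 z]
    ring
  rw [rad_def, rad_def]
  exact ScaleSubmultiplicativity.Descent.radical_mul_radical_le hA0 hS0 hB0 hn0 hdvd
    fun p hp hpA hpS => ScaleSubmultiplicativity.Descent.prime_dvd_index hn hxz hcop hp hpA hpS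

end Summit.ABC.ABC.Theorems
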